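import Mathlib
import Summits.CriticalPhenomena.PercolationContinuityZ3.Theorems.PercNearOneGluingNoHeavyLowerTailDiffHurwitzMesh
import Summits.CriticalPhenomena.PercolationContinuityZ3.Theorems.PercNearOneGluingNoHeavyLowerTailFallingClosedForm
import HarnessLib

/-!
# COROLLARY E: the operator Hurwitz matrix of equal-ratio sub-neutral copies is totally nonnegative

Support file for the Sahi / Conjecture-P programme of route `PercNearOneGluingNoHeavy`
(`--supports stmt-CriticalPhenomena-4575`, prover prim-l12-p5 gen 48; proof note
`prim-l12-p5/PROOF-DIFFERENCE-HURWITZ-g48.md` §3.1).  No definitions, no named facts, no sorries.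

For `T` copies `φ_s(X) = g_s (X + κ)` with the same idle ratio (`b_s = κ g_s`, `κ ≥ 0`, `0 < g_s < 1`) at level
`q > 0` the λ-free band matrix `W_T^{(q)}(n,l) = [X^l] Σ_j e_j(φ) ∂^j X^n/(q)_j` (g45 (1.2), g46 §0) is
`W(n,l) = κ^{n-l} Σ_{j ≤ T} e_j(g) · n(n-1)⋯(n-j+1)/(q)_j · C(j, n-l)`, `e_j(g)` the elementary symmetric
functions (given by their Pascal recursion), and its operator Hurwitz matrix is `R(W) = interleave(W, C)` with
the commutator rows `C(n,l) = W(n+1,l) - W(n,l-1)`.  **THEOREM (`DiffHurwitz.equalRatio_hurwitz_tn`)**: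
`R(W)` is totally nonnegative.  Proof: `W = P(Θ₀)` for the falling-factorial polynomial
`P = Σ_j e_j(g) X(X-1)⋯(X-j+1)/(q)_j` (`Θ₀ = κD + N̂`; the identity `C(n,l) j^{(n-l)} l^{(j-n+l)} = n^{(j)} C(j,n-l)`
and `Δ^d x^{(j)} = j^{(d)} x^{(j-d)}`), THEOREM Λ (`fallingMesh_roots_pos`, via `closedForm_rec`) and
THEOREM R^sep (`diffHurwitz_tn'`) through `fallingMesh_diffHurwitz_tn` / `rowB_eq_comm`.  With g46's REDUCTION
THEOREM this gives 𝒪₀ for (T equal-ratio sub-neutral copies + one arbitrary sub-neutral copy).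
-/

namespace Summit.CriticalPhenomena.PercolationContinuityZ3.Theorems

namespace DiffHurwitz

open Finset Polynomial FallingMesh fwdDiff

/-- `Δ^d` of a falling factorial: `Δ^d D_j = j^{(d)} · D_{j-d}` (as real functions). -/
theorem fwdDiff_iter_descPochhammer (d j : ℕ) (x : ℝ) :
    (Δ_[(1 : ℝ)])^[d] (fun y => (descPochhammer ℝ j).eval y) x =
      (j.descFactorial d : ℝ) * (descPochhammer ℝ (j - d)).eval x := by
  induction d generalizing x with
  | zero => simp
  | succ d ih =>
    rw [Function.iterate_succ_apply', fwdDiff, ih, ih, Nat.descFactorial_succ]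
    rcases Nat.lt_or_ge d j with hdj | hdj
    · obtain ⟨m, hm⟩ : ∃ m, j - d = m + 1 := ⟨j - d - 1, by omega⟩
      have hstep : (descPochhammer ℝ (m + 1)).eval (x + 1) - (descPochhammer ℝ (m + 1)).eval x
          = (m + 1 : ℝ) * (descPochhammer ℝ m).eval x := by
        have h := congr_arg (fun p : ℝ[X] => p.eval (x + 1)) (descPochhammer_succ_comp_X_sub_one ℝ m)
        simp only [eval_comp, eval_sub, eval_X, eval_one, smul_eq_mul, eval_mul, eval_add, eval_natCast,
          add_sub_cancel_right] at h
        linarith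
      rw [hm, show j - (d + 1) = m by omega, ← mul_sub, hstep, ← mul_assoc]
      congr 1
      have : (j - d : ℕ) = m + 1 := hm
      push_cast [this]
      ring
    · rw [show j - (d + 1) = 0 by omega, show j - d = 0 by omega]
      simp

/-- The combinatorial identity behind `W = P(Θ₀)`:  `C(n, n-d) · j^{(d)} · (n-d)^{(j-d)} = n^{(j)} · C(j,d)` for
`d ≤ n`. -/
theorem choose_descFactorial_identity (n d j : ℕ) (hd : d ≤ n) :
    ((n.choose (n - d) : ℕ) : ℝ) * (j.descFactorial d) * ((n - d).descFactorial (j - d))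
      = (n.descFactorial j : ℝ) * (j.choose d) := by
  rcases Nat.lt_or_ge j d with hjd | hjd
  · rw [Nat.descFactorial_eq_zero_iff_lt.2 hjd, Nat.choose_eq_zero_of_lt hjd]; simp
  rcases Nat.lt_or_ge n j with hnj | hnj
  · rw [Nat.descFactorial_eq_zero_iff_lt.2 hnj,
      Nat.descFactorial_eq_zero_iff_lt.2 (show n - d < j - d by omega)]; simp
  -- all quantities are factorial quotients
  have hfact : ∀ m : ℕ, ((Nat.factorial m : ℕ) : ℝ) ≠ 0 := fun m => by positivity
  have e1 : ((n.choose (n - d) : ℕ) : ℝ) = (Nat.factorial n : ℝ) / ((Nat.factorial (n - d) : ℝ) * (Nat.factorial d : ℝ)) := by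
    rw [Nat.cast_choose ℝ (Nat.sub_le n d), show n - (n - d) = d by omega]
  have e2 : ((j.descFactorial d : ℕ) : ℝ) = (Nat.factorial j : ℝ) / (Nat.factorial (j - d) : ℝ) := by
    rw [eq_div_iff (hfact _), ← Nat.cast_mul, mul_comm, Nat.factorial_mul_descFactorial hjd]
  have e3 : (((n - d).descFactorial (j - d) : ℕ) : ℝ) = (Nat.factorial (n - d) : ℝ) / (Nat.factorial (n - j) : ℝ) := by
    rw [eq_div_iff (hfact _), ← Nat.cast_mul, mul_comm, show n - j = (n - d) - (j - d) by omega,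
      Nat.factorial_mul_descFactorial (show j - d ≤ n - d by omega)]
  have e4 : ((n.descFactorial j : ℕ) : ℝ) = (Nat.factorial n : ℝ) / (Nat.factorial (n - j) : ℝ) := by
    rw [eq_div_iff (hfact _), ← Nat.cast_mul, mul_comm, Nat.factorial_mul_descFactorial hnj]
  have e5 : ((j.choose d : ℕ) : ℝ) = (Nat.factorial j : ℝ) / ((Nat.factorial d : ℝ) * (Nat.factorial (j - d) : ℝ)) :=
    Nat.cast_choose ℝ hjd
  have hf1 := hfact (n - d); have hf2 := hfact (j - d); have hf3 := hfact (n - j); have hf4 := hfact d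
  rw [e1, e2, e3, e4, e5]
  field_simp

/-- **COROLLARY E.**  Let `κ ≥ 0`, `q > 0`, `0 < g_t < 1`, `e T j = e_j(g_0,…,g_{T-1})` (Pascal recursion), and let
`W(n,l) = [l ≤ n] κ^{n-l} Σ_{j ≤ T} e_j · n^{(j)}/(q)_j · C(j, n-l)` be the λ-free band matrix of the `T` equal-ratio
copies `φ_s = g_s(X + κ)` at level `q`.  Then the operator Hurwitz matrix — rows `2n ↦ W(n,·)`,
`2n+1 ↦ W(n+1,·) - W(n,·-1)` — is totally nonnegative. -/
theorem equalRatio_hurwitz_tn (κ q : ℝ) (hκ : 0 ≤ κ) (hq : 0 < q) (T : ℕ) (g : ℕ → ℝ)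
    (hg : ∀ t, 0 < g t ∧ g t < 1) (e : ℕ → ℕ → ℝ) (he00 : e 0 0 = 1) (he0s : ∀ j, e 0 (j + 1) = 0)
    (hes0 : ∀ t, e (t + 1) 0 = e t 0) (hess : ∀ t j, e (t + 1) (j + 1) = e t (j + 1) + g t * e t j)
    (W : ℕ → ℕ → ℝ)
    (hW : ∀ n l, W n l = if l ≤ n then κ ^ (n - l) * ∑ j ∈ range (T + 1),
      e T j * (n.descFactorial j : ℝ) / (∏ i ∈ range j, (q + (i : ℝ))) * (j.choose (n - l) : ℝ) else 0)
    {m : ℕ} (r s : Fin m → ℕ) (hr : StrictMono r) (hs : StrictMono s) :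
    0 ≤ (Matrix.of fun i j =>
      if r i % 2 = 0 then W (r i / 2) (s j)
      else W (r i / 2 + 1) (s j) - if 1 ≤ s j then W (r i / 2) (s j - 1) else 0).det := by
  -- the falling-factorial polynomial and the rows of P(Θ₀)
  set P : ℕ → ℝ → ℝ[X] := fun t q' => ∑ j ∈ range (t + 1),
    C (e t j / ∏ i ∈ range j, (q' + (i : ℝ))) * descPochhammer ℝ j with hPdef
  obtain ⟨hP0, hPs⟩ := closedForm_rec g e he00 he0s hes0 hess P (fun t q' => rfl)
  set A : (ℝ → ℝ) → ℕ → ℕ → ℝ := fun f n l =>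
    if l ≤ n then (n.choose l : ℝ) * κ ^ (n - l) * (Δ_[(1 : ℝ)])^[n - l] f l else 0 with hAdef
  have hA : ∀ f n l, A f n l =
      if l ≤ n then (n.choose l : ℝ) * κ ^ (n - l) * (Δ_[(1 : ℝ)])^[n - l] f l else 0 := fun f n l => rfl
  -- W = A applied to the evaluation function of P T q
  have hWA : ∀ n l, W n l = A (fun x => (P T q).eval x) n l := by
    intro n l
    rw [hW, hA]
    split_ifs with hln
    · have hev : (fun x => (P T q).eval x) = ∑ j ∈ range (T + 1),
          (e T j / ∏ i ∈ range j, (q + (i : ℝ))) • fun y => (descPochhammer ℝ j).eval y := by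
        funext x
        simp only [hPdef, eval_finsetSum, eval_mul, eval_C, Finset.sum_apply, Pi.smul_apply, smul_eq_mul]
      rw [hev, fwdDiff_iter_finsetSum, Finset.sum_apply, mul_sum, mul_sum]
      refine sum_congr rfl fun j _ => ?_
      rw [fwdDiff_iter_const_smul, Pi.smul_apply, smul_eq_mul, fwdDiff_iter_descPochhammer,
        descPochhammer_eval_eq_descFactorial]
      have hid := choose_descFactorial_identity n (n - l) j (Nat.sub_le n l)
      rw [show n - (n - l) = l by omega] at hid
      linear_combination (-(κ ^ (n - l) * (e T j / ∏ i ∈ range j, (q + (i : ℝ))))) * hid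
    · rfl
  have hM : (Matrix.of fun i j =>
      if r i % 2 = 0 then W (r i / 2) (s j)
      else W (r i / 2 + 1) (s j) - if 1 ≤ s j then W (r i / 2) (s j - 1) else 0) =
      Matrix.of fun i j =>
      if r i % 2 = 0 then A (fun x => (P T q).eval x) (r i / 2) (s j)
      else κ * A (fun x => (P T q).eval (x + 1) - (P T q).eval x) (r i / 2) (s j)
        + if 1 ≤ s j then A (fun x => (P T q).eval (x + 1) - (P T q).eval x) (r i / 2) (s j - 1) else 0 := by
    ext i j
    simp only [Matrix.of_apply]
    by_cases h : r i % 2 = 0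
    · simp only [if_pos h, hWA]
    · simp only [if_neg h, hWA]
      exact (rowB_eq_comm κ A hA (fun x => (P T q).eval x) (r i / 2) (s j)).symm
  rw [hM]
  exact fallingMesh_diffHurwitz_tn κ hκ A hA P g hg hP0 hPs T q hq r s hr hs

end DiffHurwitz

end Summit.CriticalPhenomena.PercolationContinuityZ3.Theorems
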